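/-
Copyright: the b2b-balaban cell (near-miss cell 7), T⁴-continuum CRUX team (coordinator ruling e34b3e0c item (2)),
lineage t4-ne7b-formalise-leaf-02 (gen 127; E-side ∕ key-readings). Released under the licence of the surrounding project.
-/
import Summits.QuantumFields.BalabanUV.T4Continuum.Spine.NE7b.GaussianInducedMeanDecay
import Literature.MathematicalPhysics.QuantumFieldTheory.Balaban1983to89.B4Sect5Torus

/-!
# THE INDUCED MEAN IN PRINT'S DECAY LETTERS: [B4] Sect. 5 (5.6) ⇒ (5.7) and the lattice-sum PROFILE give `B₀` volume-free
# (row NE7b, node U5c; the (R1″) ∕ (R1′b) residual of the LCS road — a junction to the tree's `…Balaban1983to89.B4Sect5Torus`)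

Cell `pub-balaban/t4`, spine estimate NE7b (`T4WeightBudget.RelWeightBound`; the cell's OWN estimate — NOT PRINTED in
[Bałaban 1983–89], NOT PROVED).  [folklore] finite sums + compositions BY NAME of (i) `pub-balaban-gaps` ne6's
`…GaussianInducedMeanDecay` (F1) and the OWNER's `…GaussianShiftedFibre`, (ii) the `lit-balaban` Literature module
`…Balaban1983to89.B4Sect5Torus` — Bałaban's *Regularity and decay of lattice Green's functions* [B4] Sect. 5 Theorem
(p. 594: (5.6) ⇒ (5.7)) PROVED there over every finite pseudo-metric index set with a lattice-sum profile (`sect5_uniform`,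
`inv_decay`), with the ℤ^d-region and discrete-torus instances (`zrho_sumBound`, `trho_sumBound`).  NOTHING of Bałaban's is
asserted here: the decay is a THEOREM of the tree, consumed by name; 0 `def`, 0 `sorry`; no `T4Continuum/Support` leaf (FREEZE (0)).

WHY.  F1 discharges the OWNER's displayed induced-mean hypothesis `hB : mᵀQm ≤ B₀` from a DECAY LETTER
`|S⁻¹ i k| ≤ C·e^{−μ d(i,k)}` (fed there by Combes–Thomas for BANDED `S`, `d ≤ 1` bands) and a buffer, with `#D` in `B₀`
(crux refuter κ-ne7bref-g67-1).  Print's fluctuation forms after `k` steps are NOT banded: their kernels DECAY —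
`|S(x,x′)| ≤ c₀e^{−δ₀|x−x′|}`, `S ≥ γ₀` — which is EXACTLY hypothesis (5.6) of [B4] Sect. 5 (`B4Sect5Torus.Hyp56 ρ S γ₀ c₀ δ₀`),
and print's lattices carry the PROFILE `Σ_y e^{−aρ(x,y)} ≤ K(a)` (`B4Sect5Torus.SumBound ρ K`; on every torus region with `N`
components `K(a) = N·(2∕(1−e^{−a∕d}))^d`, UNIFORMLY in the period vector — `trho_sumBound`).  THIS FILE: (§1) the PROFILE alone
makes the buffer sum volume-free — `Σ_{l∈D} e^{−μρ(j,l)} ≤ K(a)·e^{−(μ−a)R}` for `0 < a ≤ μ`, `ρ(j, D) ≥ R` (`R : ℝ`, F1's buffer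
letter verbatim); (§2) junctions onto F1 ∕ the OWNER's H; (§3) THE DECAY LETTER FROM PRINT: under `Hyp56 ρ S γ₀ c₀ δ₀` + profile +
pseudo-distance, `|S⁻¹ p q| ≤ (2∕γ₀)·e^{−δ₁ρ(p,q)}`, `δ₁ = B4Sect5Torus.rate K γ₀ c₀ δ₀` (= [B4] (5.7), the tree's `inv_decay`) ⟹
`mᵀQm ≤ q₀·#Z·((2∕γ₀)·V·K(a)·e^{−(δ₁−a)R})²` and the OWNER's shifted moment with `hB` DISCHARGED from (5.6)-letters; (§4) the
DISCRETE TORUS instance BY NAME (`TIdx P Ω N`, `trho`, `K = N·latticeConst d`): constants depend on `(d, N, γ₀, c₀, δ₀, a)` ONLY —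
not on the periods `P`, not on the region `Ω`, not on `#D`.

WHAT IS PROVED ([folklore] + tree theorems by name):
* §1 `exp_neg_mul_le_of_le` (rate splitting), **`sum_exp_le_of_sumBound`** (`SumBound ρ K`, `0 < a ≤ μ`, `R ≤ ρ(j,l)` on `D` ⊢
  `Σ_{l∈D} e^{−μρ(j,l)} ≤ K a·e^{−(μ−a)R}`), `sum_exp_le_of_sumBound₀` (no buffer: `≤ K μ`).
* §2 **`abs_inv_mulVec_le_sumBound`**, **`rowSum_response_le_sumBound`** (σ-1's `t_Z`), **`inducedMeanEnergy_le_of_sumBound`**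
  (`mᵀQm ≤ q₀·#Z·(C·V·(K a·e^{−(μ−a)R}))²`), `windowEnergy_le_of_sumBound` ((R1′c) nesting letters, `R = 0`: `(C·V·K μ)²`),
  **`shiftedMoment_le_of_sumBound`** (the OWNER's `shiftedMoment_le_of_inducedMean_le`, `hB` DISCHARGED; `hmass` displayed).
* §3 `posDef_of_hyp56` ((5.6) ⇒ `S.PosDef`), **`inducedMeanEnergy_le_of_hyp56`** (DECAY FROM PRINT: `Hyp56` + profile ⊢
  `mᵀQm ≤ q₀·#Z·((2∕γ₀)·V·(K a·e^{−(δ₁−a)R}))²`, `δ₁ = rate K γ₀ c₀ δ₀`), **`shiftedMoment_le_of_hyp56`** (the shifted restricted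
  moment with BOTH `hS : S.PosDef` and `hB` discharged from (5.6) + profile + interface + buffer).
* §4 **`inducedMeanEnergy_le_on_torusRegion`** (`n = TIdx P Ω N` — sites of a region `Ω` of the torus `Π_i ℤ∕P_iℤ` × `N` internal
  indices; `ρ = trho`, `K(a) = N·latticeConst d a`; uniform in `P` and `Ω`).
NOT HERE (honest): that Bałaban's step-`k` fluctuation forms in a background SATISFY (5.6) with `(γ₀, c₀, δ₀)` uniform in the
running coupling and in `k` (print: [B15] §1 ∕ [B13]–[B14] propagator estimates — an (A1c) READING), the interface reading
`D, V`, the buffer `R` with `e^{(δ₁−a)R} ≥ (2∕γ₀)·V·K(a)`: the (A1c) INSTANCE (NC-NE7b-α UNRULED) — not claimed; (R1′c)'s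
maximum-principle ∕ inflation clause, (R2′), (A3); anything of Bałaban's beyond the cited tree theorem.  BY-NAME EFFECT ON THE
WALL: NONE (a model supplier whose decay letter is now a PRINTED theorem of the tree instead of a display).  NE7b NOT PRINTED ∕
NOT PROVED; spine PROVED 0∕9; rung (B)+1 on ONE finite T⁴ — NOT infinite volume, NOT the mass gap, NOT Clay.  HONEST DEPENDENCY:
continuum YM on T⁴ ⇐ BetaPertH ∧ nine spine estimates (0∕9 proved); BetaPertH ⇐ (D1) ∧ (D4) ∧ CAP+tail; G-an2-4 gates asym,
D1 and NE2∕3∕4.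
-/

set_option autoImplicit false
open Matrix Finset MeasureTheory Real
open Summit.QuantumFields.BalabanUV.T4Continuum.NE7b.GaussianShiftedFibre
open Summit.QuantumFields.BalabanUV.T4Continuum.NE7b.GaussianInducedMeanDecay
open Literature.MathematicalPhysics.QuantumFieldTheory.Balaban1983to89
open Literature.MathematicalPhysics.QuantumFieldTheory.Balaban1983to89.B4Sect5Torus

namespace Summit.QuantumFields.BalabanUV.T4Continuum.NE7b.InducedMeanRegularityDecay
variable {n : Type*} [Fintype n] [DecidableEq n]

/-! ## §1 The lattice-sum PROFILE makes the buffer sum volume-free -/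

omit [Fintype n] [DecidableEq n] in
/-- Rate splitting: for `a ≤ μ` and `R ≤ t`, `e^{−μt} ≤ e^{−(μ−a)R}·e^{−at}`. [folklore] -/
theorem exp_neg_mul_le_of_le {μ a R t : ℝ} (haμ : a ≤ μ) (hRt : R ≤ t) :
    exp (-(μ * t)) ≤ exp (-((μ - a) * R)) * exp (-(a * t)) := by
  rw [← Real.exp_add]
  exact exp_le_exp.2 (by nlinarith)

omit [DecidableEq n] in
/-- **THE BUFFER SUM UNDER A PROFILE.**  If `Σ_y e^{−aρ(x,y)} ≤ K(a)` for all rates `a > 0` (`SumBound ρ K` — volume-free by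
hypothesis; PROVED for ℤ^d regions and tori in `B4Sect5Torus`), then for `0 < a ≤ μ` and an interface `D` at `ρ`-distance `≥ R` from
`j`: `Σ_{l∈D} e^{−μρ(j,l)} ≤ K(a)·e^{−(μ−a)R}` — no `#D`; `R : ℝ` as in F1. [folklore] -/
theorem sum_exp_le_of_sumBound {ρ : n → n → ℝ} {K : ℝ → ℝ} (hS : SumBound ρ K) {μ a : ℝ} (ha : 0 < a) (haμ : a ≤ μ)
    (D : Finset n) (j : n) {R : ℝ} (hR : ∀ l ∈ D, R ≤ ρ j l) :
    ∑ l ∈ D, exp (-(μ * ρ j l)) ≤ K a * exp (-((μ - a) * R)) := by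
  calc ∑ l ∈ D, exp (-(μ * ρ j l)) ≤ ∑ l ∈ D, exp (-((μ - a) * R)) * exp (-(a * ρ j l)) :=
        Finset.sum_le_sum fun l hl => exp_neg_mul_le_of_le haμ (hR l hl)
    _ = exp (-((μ - a) * R)) * ∑ l ∈ D, exp (-(a * ρ j l)) := by rw [Finset.mul_sum]
    _ ≤ exp (-((μ - a) * R)) * ∑ l, exp (-(a * ρ j l)) :=
        mul_le_mul_of_nonneg_left
          (Finset.sum_le_univ_sum_of_nonneg fun _ => (exp_pos _).le) (exp_pos _).le
    _ ≤ exp (-((μ - a) * R)) * K a := mul_le_mul_of_nonneg_left (hS a ha j) (exp_pos _).le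
    _ = K a * exp (-((μ - a) * R)) := mul_comm _ _

omit [DecidableEq n] in
/-- The same WITHOUT a buffer: `Σ_{l∈D} e^{−μρ(j,l)} ≤ K(μ)` for `μ > 0`. [folklore] -/
theorem sum_exp_le_of_sumBound₀ {ρ : n → n → ℝ} {K : ℝ → ℝ} (hS : SumBound ρ K) {μ : ℝ} (hμ : 0 < μ)
    (D : Finset n) (j : n) : ∑ l ∈ D, exp (-(μ * ρ j l)) ≤ K μ :=
  (Finset.sum_le_univ_sum_of_nonneg fun _ => (exp_pos _).le).trans (hS μ hμ j)

/-! ## §2 Junctions BY NAME onto F1 and the OWNER's H -/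

/-- **THE INDUCED MEAN UNDER A DECAY LETTER AND A PROFILE** (= F1's `abs_inv_mulVec_le_sum` + §1): decay `|S⁻¹ i k| ≤ C·e^{−μρ(i,k)}`,
exterior term on `D` with `|v| ≤ V` (`V ≥ 0`), profile `SumBound ρ K`, `0 < a ≤ μ`, buffer `ρ(j, D) ≥ R` ⟹
`|(S⁻¹v) j| ≤ C·V·(K a·e^{−(μ−a)R})`. [folklore] -/
theorem abs_inv_mulVec_le_sumBound (S : Matrix n n ℝ) {C μ : ℝ} (ρ : n → n → ℝ)
    (hdec : ∀ i k, |S⁻¹ i k| ≤ C * Real.exp (-(μ * ρ i k)))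
    (D : Finset n) (v : n → ℝ) (hvD : ∀ l, l ∉ D → v l = 0) {V : ℝ} (hV0 : 0 ≤ V) (hV : ∀ l ∈ D, |v l| ≤ V)
    (j : n) {K : ℝ → ℝ} (hS : SumBound ρ K) {a : ℝ} (ha : 0 < a) (haμ : a ≤ μ) {R : ℝ} (hR : ∀ l ∈ D, R ≤ ρ j l) :
    |(S⁻¹ *ᵥ v) j| ≤ C * V * (K a * exp (-((μ - a) * R))) :=
  (abs_inv_mulVec_le_sum S ρ hdec D v hvD hV j).trans
    (mul_le_mul_of_nonneg_left (sum_exp_le_of_sumBound hS ha haμ D j hR)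
      (mul_nonneg (decayConst_nonneg S ρ hdec j) hV0))

/-- **THE RESPONSE MAP'S ROW SUMS UNDER A PROFILE** (σ-1's `t_Z`, volume-free; = F1's `rowSum_response_le` + §1). [folklore] -/
theorem rowSum_response_le_sumBound {m : Type*} [Fintype m] (S : Matrix n n ℝ) {C μ : ℝ} (ρ : n → n → ℝ)
    (hdec : ∀ i k, |S⁻¹ i k| ≤ C * Real.exp (-(μ * ρ i k))) (S₁₂ : Matrix n m ℝ) (D : Finset n)
    (hrow : ∀ l a, S₁₂ l a ≠ 0 → l ∈ D) {s : ℝ} (hs0 : 0 ≤ s) (hs : ∀ l, ∑ a, |S₁₂ l a| ≤ s) (j : n)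
    {K : ℝ → ℝ} (hS : SumBound ρ K) {a : ℝ} (ha : 0 < a) (haμ : a ≤ μ) {R : ℝ} (hR : ∀ l ∈ D, R ≤ ρ j l) :
    ∑ b, |(S⁻¹ * S₁₂) j b| ≤ C * s * (K a * exp (-((μ - a) * R))) :=
  (rowSum_response_le S ρ hdec S₁₂ D hrow hs j).trans
    (mul_le_mul_of_nonneg_left (sum_exp_le_of_sumBound hS ha haμ D j hR)
      (mul_nonneg (decayConst_nonneg S ρ hdec j) hs0))

/-- **`B₀` UNDER A DECAY LETTER AND A PROFILE, VOLUME-FREE** (= F1's `qf_le_card_mul_sq` + the former): decay letter, `Q` positive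
semidefinite living on `Z` with `Q ≤ q₀·1`, exterior term on `D` with `|v| ≤ V`, profile, `0 < a ≤ μ`, buffer `ρ(i,l) ≥ R` for
`i ∈ Z`, `l ∈ D` ⟹ `mᵀQm ≤ q₀·#Z·(C·V·(K a·e^{−(μ−a)R}))²` — no `#D`, no volume. [folklore] -/
theorem inducedMeanEnergy_le_of_sumBound (S Q : Matrix n n ℝ) {C μ : ℝ} (ρ : n → n → ℝ)
    (hdec : ∀ i k, |S⁻¹ i k| ≤ C * Real.exp (-(μ * ρ i k)))
    (hQ : Q.PosSemidef) (Z : Finset n) (hQZ : ∀ i j, j ∉ Z → Q i j = 0) {q₀ : ℝ} (hq₀ : 0 ≤ q₀)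
    (hQq : (q₀ • (1 : Matrix n n ℝ) - Q).PosSemidef)
    (D : Finset n) (v : n → ℝ) (hvD : ∀ l, l ∉ D → v l = 0) {V : ℝ} (hV0 : 0 ≤ V) (hV : ∀ l ∈ D, |v l| ≤ V)
    {K : ℝ → ℝ} (hS : SumBound ρ K) {a : ℝ} (ha : 0 < a) (haμ : a ≤ μ)
    {R : ℝ} (hR : ∀ i ∈ Z, ∀ l ∈ D, R ≤ ρ i l) :
    (S⁻¹ *ᵥ v) ⬝ᵥ (Q *ᵥ (S⁻¹ *ᵥ v)) ≤ q₀ * Z.card * (C * V * (K a * exp (-((μ - a) * R)))) ^ 2 :=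
  qf_le_card_mul_sq hQ Z hQZ hQq hq₀ _ fun i hi =>
    abs_inv_mulVec_le_sumBound S ρ hdec D v hvD hV0 hV i hS ha haμ (hR i hi)

/-- **THE NESTING LETTERS UNDER A PROFILE, NO BUFFER** (= F1 §6 `windowEnergy_le_of_decay` with `#D ↦ K(μ)`): for a window form `Q_b`
on `Z_b` with `Q_b ≤ q_b·1`, a decay letter of rate `μ > 0` and a pseudo-distance (`IsPseudoDist ρ`, for non-negativity):
`mᵀQ_bm ≤ q_b·#Z_b·(C·V·K(μ))²`. [folklore] -/
theorem windowEnergy_le_of_sumBound (S Qb : Matrix n n ℝ) {C μ : ℝ} {ρ : n → n → ℝ} (hρ : IsPseudoDist ρ) (hμ : 0 < μ)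
    (hdec : ∀ i k, |S⁻¹ i k| ≤ C * Real.exp (-(μ * ρ i k)))
    (hQb : Qb.PosSemidef) (Zb : Finset n) (hQZ : ∀ i j, j ∉ Zb → Qb i j = 0) {qb : ℝ} (hqb : 0 ≤ qb)
    (hQq : (qb • (1 : Matrix n n ℝ) - Qb).PosSemidef)
    (D : Finset n) (v : n → ℝ) (hvD : ∀ l, l ∉ D → v l = 0) {V : ℝ} (hV0 : 0 ≤ V) (hV : ∀ l ∈ D, |v l| ≤ V)
    {K : ℝ → ℝ} (hS : SumBound ρ K) :
    (S⁻¹ *ᵥ v) ⬝ᵥ (Qb *ᵥ (S⁻¹ *ᵥ v)) ≤ qb * Zb.card * (C * V * K μ) ^ 2 := by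
  have h := inducedMeanEnergy_le_of_sumBound S Qb ρ hdec hQb Zb hQZ hqb hQq D v hvD hV0 hV hS hμ le_rfl
    (R := 0) (fun i _ l _ => hρ.nonneg i l)
  simpa only [sub_self, zero_mul, neg_zero, Real.exp_zero, mul_one] using h

/-- **THE SHIFTED RESTRICTED MOMENT UNDER A PROFILE** = the OWNER's `…GaussianShiftedFibre.shiftedMoment_le_of_inducedMean_le` with
`hB` DISCHARGED by `inducedMeanEnergy_le_of_sumBound`: the exterior coupling costs `exp((1+ε⁻¹)·q₀·#Z·(C·V·K(a)·e^{−(μ−a)R})²)` —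
no `#D`; `hmass` stays displayed ((R1′c)). [folklore] -/
theorem shiftedMoment_le_of_sumBound {S Q : Matrix n n ℝ} {δ' ε η : ℝ} {r : ℕ} (hSp : S.PosDef) (hQ : Q.PosSemidef)
    (hε : 0 < ε) (hdom : (δ' • S - (1 + ε) • Q).PosSemidef) (hδ0 : 0 ≤ δ') (hδ : δ' < 1) (hr : Q.rank ≤ r)
    (v : n → ℝ) {F : (n → ℝ) → ℝ} (hF0 : ∀ x, 0 ≤ F x) (hF1 : ∀ x, F x ≤ 1) (hFm : Measurable F) (hη : η < 1)
    (hmass : ∫ u, (1 - F (u - S⁻¹ *ᵥ v)) * exp (-(u ⬝ᵥ (S *ᵥ u))) ≤ η * ∫ u, exp (-(u ⬝ᵥ (S *ᵥ u))))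
    {C μ : ℝ} (ρ : n → n → ℝ) (hdec : ∀ i k, |S⁻¹ i k| ≤ C * Real.exp (-(μ * ρ i k)))
    (Z : Finset n) (hQZ : ∀ i j, j ∉ Z → Q i j = 0) {q₀ : ℝ} (hq₀ : 0 ≤ q₀)
    (hQq : (q₀ • (1 : Matrix n n ℝ) - Q).PosSemidef)
    (D : Finset n) (hvD : ∀ l, l ∉ D → v l = 0) {V : ℝ} (hV0 : 0 ≤ V) (hV : ∀ l ∈ D, |v l| ≤ V)
    {K : ℝ → ℝ} (hS : SumBound ρ K) {a : ℝ} (ha : 0 < a) (haμ : a ≤ μ)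
    {R : ℝ} (hR : ∀ i ∈ Z, ∀ l ∈ D, R ≤ ρ i l) :
    ∫ x, F x * (exp (x ⬝ᵥ (Q *ᵥ x)) * exp (-(x ⬝ᵥ (S *ᵥ x) + 2 * (x ⬝ᵥ v)))) ≤
      (exp ((1 + ε⁻¹) * (q₀ * Z.card * (C * V * (K a * exp (-((μ - a) * R)))) ^ 2)) *
          ((√(1 - δ'))⁻¹ ^ r / (1 - η))) *
        ∫ x, F x * exp (-(x ⬝ᵥ (S *ᵥ x) + 2 * (x ⬝ᵥ v))) :=
  shiftedMoment_le_of_inducedMean_le hSp hQ hε hdom hδ0 hδ hr v hF0 hF1 hFm hη hmass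
    (inducedMeanEnergy_le_of_sumBound S Q ρ hdec hQ Z hQZ hq₀ hQq D v hvD hV0 hV hS ha haμ hR)

/-! ## §3 THE DECAY LETTER FROM PRINT: [B4] Sect. 5, (5.6) ⇒ (5.7) — the tree's `B4Sect5Torus.inv_decay` BY NAME -/

omit [DecidableEq n] in
/-- **(5.6) ⇒ positive definite**: a symmetric real matrix with `γ₀·‖x‖² ≤ xᵀSx`, `γ₀ > 0`, is positive definite. [folklore] -/
theorem posDef_of_hyp56 {ρ : n → n → ℝ} {S : Matrix n n ℝ} {γ₀ c₀ δ₀ : ℝ} (hγ : 0 < γ₀) (h56 : Hyp56 ρ S γ₀ c₀ δ₀) :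
    S.PosDef := by
  refine Matrix.posDef_iff_dotProduct_mulVec.2 ⟨?_, fun x hx => ?_⟩
  · rw [Matrix.IsHermitian, Matrix.conjTranspose_eq_transpose_of_trivial]
    exact h56.1
  · have hc := h56.2.1 x
    obtain ⟨p, hp⟩ := Function.ne_iff.1 hx
    have hp2 : 0 < x p ^ 2 := sq_pos_iff.2 hp
    have hpos : 0 < ∑ q, x q ^ 2 :=
      lt_of_lt_of_le hp2
        (Finset.single_le_sum (f := fun q => x q ^ 2) (fun q _ => sq_nonneg (x q)) (Finset.mem_univ p))
    have e : star x ⬝ᵥ (S *ᵥ x) = ∑ q, x q * S.mulVec x q := by rw [star_trivial]; rfl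
    rw [e]
    nlinarith

/-- **`B₀` FROM PRINT'S LETTERS** ([B4] Sect. 5 Theorem, (5.6) ⇒ (5.7), as PROVED in the tree).  Let the index set carry a
pseudo-distance `ρ` (`IsPseudoDist`) with a lattice-sum profile `K` (`SumBound`, `K ≥ 0` on positive rates), and let the
fluctuation form `S` satisfy (5.6): symmetric, `S ≥ γ₀`, `|S(p,q)| ≤ c₀e^{−δ₀ρ(p,q)}` (`Hyp56 ρ S γ₀ c₀ δ₀`; `γ₀, δ₀ > 0`, `c₀ ≥ 0`).
Then (5.7) `|S⁻¹(p,q)| ≤ (2∕γ₀)e^{−δ₁ρ(p,q)}`, `δ₁ = rate K γ₀ c₀ δ₀ > 0` (`inv_decay`), and for `Q` on `Z` with `Q ≤ q₀·1`, an exterior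
term on `D` with `|v| ≤ V`, `0 < a ≤ δ₁` and the buffer `ρ(Z, D) ≥ R`:
`mᵀQm ≤ q₀·#Z·((2∕γ₀)·V·(K a·e^{−(δ₁−a)R}))²` — every constant a function of `(γ₀, c₀, δ₀, K, a)`: no `#D`, no volume.
[cite locus: the tree's `B4Sect5Torus.inv_decay`; this composition folklore] -/
theorem inducedMeanEnergy_le_of_hyp56 {ρ : n → n → ℝ} {K : ℝ → ℝ} (hK : ∀ a, 0 < a → 0 ≤ K a) {γ₀ c₀ δ₀ : ℝ}
    (hγ : 0 < γ₀) (hc : 0 ≤ c₀) (hδ : 0 < δ₀) (hρ : IsPseudoDist ρ) (hS : SumBound ρ K)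
    {S : Matrix n n ℝ} (h56 : Hyp56 ρ S γ₀ c₀ δ₀)
    (Q : Matrix n n ℝ) (hQ : Q.PosSemidef) (Z : Finset n) (hQZ : ∀ i j, j ∉ Z → Q i j = 0) {q₀ : ℝ} (hq₀ : 0 ≤ q₀)
    (hQq : (q₀ • (1 : Matrix n n ℝ) - Q).PosSemidef)
    (D : Finset n) (v : n → ℝ) (hvD : ∀ l, l ∉ D → v l = 0) {V : ℝ} (hV0 : 0 ≤ V) (hV : ∀ l ∈ D, |v l| ≤ V)
    {a : ℝ} (ha : 0 < a) (ha' : a ≤ rate K γ₀ c₀ δ₀) {R : ℝ} (hR : ∀ i ∈ Z, ∀ l ∈ D, R ≤ ρ i l) :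
    (S⁻¹ *ᵥ v) ⬝ᵥ (Q *ᵥ (S⁻¹ *ᵥ v)) ≤
      q₀ * Z.card * (2 / γ₀ * V * (K a * exp (-((rate K γ₀ c₀ δ₀ - a) * R)))) ^ 2 :=
  inducedMeanEnergy_le_of_sumBound S Q ρ (inv_decay hK hγ hc hδ hρ hS h56) hQ Z hQZ hq₀ hQq D v hvD hV0 hV hS ha ha' hR

/-- **THE SHIFTED RESTRICTED MOMENT FROM PRINT'S LETTERS** = the OWNER's `shiftedMoment_le_of_inducedMean_le` with BOTH `hS : S.PosDef`
(`posDef_of_hyp56`) and `hB` (`inducedMeanEnergy_le_of_hyp56`) DISCHARGED from (5.6) + profile + interface + buffer: the exterior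
coupling of a near block whose fluctuation form obeys [B4] (5.6) costs `exp((1+ε⁻¹)·q₀·#Z·((2∕γ₀)·V·K(a)·e^{−(δ₁−a)R})²)`;
`hmass` stays displayed ((R1′c)). [folklore + `B4Sect5Torus.inv_decay`] -/
theorem shiftedMoment_le_of_hyp56 {ρ : n → n → ℝ} {K : ℝ → ℝ} (hK : ∀ a, 0 < a → 0 ≤ K a) {γ₀ c₀ δ₀ : ℝ}
    (hγ : 0 < γ₀) (hc : 0 ≤ c₀) (hδ : 0 < δ₀) (hρ : IsPseudoDist ρ) (hS : SumBound ρ K)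
    {S Q : Matrix n n ℝ} (h56 : Hyp56 ρ S γ₀ c₀ δ₀) {δ' ε η : ℝ} {r : ℕ} (hQ : Q.PosSemidef)
    (hε : 0 < ε) (hdom : (δ' • S - (1 + ε) • Q).PosSemidef) (hδ0 : 0 ≤ δ') (hδ1 : δ' < 1) (hr : Q.rank ≤ r)
    (v : n → ℝ) {F : (n → ℝ) → ℝ} (hF0 : ∀ x, 0 ≤ F x) (hF1 : ∀ x, F x ≤ 1) (hFm : Measurable F) (hη : η < 1)
    (hmass : ∫ u, (1 - F (u - S⁻¹ *ᵥ v)) * exp (-(u ⬝ᵥ (S *ᵥ u))) ≤ η * ∫ u, exp (-(u ⬝ᵥ (S *ᵥ u))))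
    (Z : Finset n) (hQZ : ∀ i j, j ∉ Z → Q i j = 0) {q₀ : ℝ} (hq₀ : 0 ≤ q₀)
    (hQq : (q₀ • (1 : Matrix n n ℝ) - Q).PosSemidef)
    (D : Finset n) (hvD : ∀ l, l ∉ D → v l = 0) {V : ℝ} (hV0 : 0 ≤ V) (hV : ∀ l ∈ D, |v l| ≤ V)
    {a : ℝ} (ha : 0 < a) (ha' : a ≤ rate K γ₀ c₀ δ₀) {R : ℝ} (hR : ∀ i ∈ Z, ∀ l ∈ D, R ≤ ρ i l) :
    ∫ x, F x * (exp (x ⬝ᵥ (Q *ᵥ x)) * exp (-(x ⬝ᵥ (S *ᵥ x) + 2 * (x ⬝ᵥ v)))) ≤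
      (exp ((1 + ε⁻¹) *
          (q₀ * Z.card * (2 / γ₀ * V * (K a * exp (-((rate K γ₀ c₀ δ₀ - a) * R)))) ^ 2)) *
          ((√(1 - δ'))⁻¹ ^ r / (1 - η))) *
        ∫ x, F x * exp (-(x ⬝ᵥ (S *ᵥ x) + 2 * (x ⬝ᵥ v))) :=
  shiftedMoment_le_of_inducedMean_le (posDef_of_hyp56 hγ h56) hQ hε hdom hδ0 hδ1 hr v hF0 hF1 hFm hη hmass
    (inducedMeanEnergy_le_of_hyp56 hK hγ hc hδ hρ hS h56 Q hQ Z hQZ hq₀ hQq D v hvD hV0 hV ha ha' hR)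

/-! ## §4 The discrete-torus instance BY NAME: `TIdx P Ω N`, `trho`, `K = N·latticeConst d` — uniform in the periods and the region -/

/-- **`B₀` ON A TORUS REGION, IN PRINT'S LETTERS, UNIFORMLY IN THE VOLUME.**  Indices `TIdx P Ω N = ↥Ω × Fin N` (sites of a region `Ω`
of the discrete torus `Π_{i<d} ℤ∕P_iℤ`, all `P_i ≥ 1`, times `N` internal indices), torus sup-distance `trho P Ω N`, profile
`K(a) = N·latticeConst d a` (`trho_sumBound`; `latticeConst d a = (2∕(1−e^{−a∕d}))^d`); fluctuation form with (5.6).  Then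
`mᵀQm ≤ q₀·#Z·((2∕γ₀)·V·(N·latticeConst d a·e^{−(δ₁−a)R}))²`, `δ₁ = rate (N·latticeConst d ·) γ₀ c₀ δ₀` — the constants depend on
`(d, N, γ₀, c₀, δ₀, a)` ONLY: not on the periods `P`, not on `Ω`, not on `#D`. [folklore + `B4Sect5Torus` by name] -/
theorem inducedMeanEnergy_le_on_torusRegion {d : ℕ} {P : Fin d → ℕ} (hP : ∀ i, 1 ≤ P i) (Ω : Finset (TSite d P)) (N : ℕ)
    {γ₀ c₀ δ₀ : ℝ} (hγ : 0 < γ₀) (hc : 0 ≤ c₀) (hδ : 0 < δ₀)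
    {S : Matrix (TIdx P Ω N) (TIdx P Ω N) ℝ} (h56 : Hyp56 (trho P Ω N) S γ₀ c₀ δ₀)
    (Q : Matrix (TIdx P Ω N) (TIdx P Ω N) ℝ) (hQ : Q.PosSemidef) (Z : Finset (TIdx P Ω N))
    (hQZ : ∀ i j, j ∉ Z → Q i j = 0) {q₀ : ℝ} (hq₀ : 0 ≤ q₀)
    (hQq : (q₀ • (1 : Matrix (TIdx P Ω N) (TIdx P Ω N) ℝ) - Q).PosSemidef)
    (D : Finset (TIdx P Ω N)) (v : TIdx P Ω N → ℝ) (hvD : ∀ l, l ∉ D → v l = 0) {V : ℝ} (hV0 : 0 ≤ V)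
    (hV : ∀ l ∈ D, |v l| ≤ V) {a : ℝ} (ha : 0 < a)
    (ha' : a ≤ rate (fun b => N * B4Sect5Proof.latticeConst d b) γ₀ c₀ δ₀)
    {R : ℝ} (hR : ∀ i ∈ Z, ∀ l ∈ D, R ≤ trho P Ω N i l) :
    (S⁻¹ *ᵥ v) ⬝ᵥ (Q *ᵥ (S⁻¹ *ᵥ v)) ≤
      q₀ * Z.card * (2 / γ₀ * V * ((N * B4Sect5Proof.latticeConst d a) *
        exp (-((rate (fun b => N * B4Sect5Proof.latticeConst d b) γ₀ c₀ δ₀ - a) * R)))) ^ 2 := by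
  classical
  exact inducedMeanEnergy_le_of_hyp56 (K := fun b => N * B4Sect5Proof.latticeConst d b)
    (fun b hb => mul_nonneg (Nat.cast_nonneg N) (B4Sect5Proof.latticeConst_nonneg d hb.le)) hγ hc hδ
    (trho_isPseudoDist hP Ω N) (trho_sumBound hP Ω N) h56 Q hQ Z hQZ hq₀ hQq D v hvD hV0 hV ha ha' hR

end Summit.QuantumFields.BalabanUV.T4Continuum.NE7b.InducedMeanRegularityDecay
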